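import Mathlib
import HarnessLib
import Summits.HubbardSuperconductivity.HubbardSuperconductivity.Theorems.KLProgrammeC4aPPKernelTrueFlatnessShape
import Summits.HubbardSuperconductivity.HubbardSuperconductivity.Theorems.KLProgrammeC4aPPKernelRatioForm
import Literature.Analysis.SpecialFunctions.MatsubaraShiftedSum

/-!
# Route `KLProgramme` — crux C4a, S3 brick (B4) «(B4)-UMK1», «(M1)-TRUE-KERNEL» adaptation (Ω), part 1: the pp pair numerator at NONZERO TRANSFER FREQUENCY
# `Ω = 2mπ/β` — `ℤ`-indexed complex series, summability, symmetry, and level derivatives everywhere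

Cell `gate-hubbard-kl`, seat hubbard-kl-k3c3-p1 (g15; row «δμ-flow with klAngularMean constant piece»).  The last residual of #13 (note `M1-TRUE-KERNEL.md` §6): the
model's pair kernel for external/slice frequencies `(κ, p₀)` has transfer frequency `Ω = κ + p₀ ∈ (2π/β)ℤ`, partner frequency `Ω − ω`:
`K_Ω(e,u) = (1/β)Σ_{n∈ℤ} Ψ̂(ωₙ,e)·Ψ̂(Ω−ωₙ,u)`, `Ψ̂ = uvSymbolFnXi 1 Λ`, `ωₙ = (2n+1)π/β`.  By `…RatioForm`, `K_Ω = N_Ω/(e+u−iΩ)` with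
`N_Ω(e,u) = (1/β)Σ_{n∈ℤ} W(ωₙ,e)W(Ω−ωₙ,u)[1/(−iωₙ+e) + 1/(−i(Ω−ωₙ)+u)]` — the COMBINED bracket is `O(1/ωₙ²)` (it equals `Ψ̂Ψ̂′·(e+u−iΩ)`), so the series is
absolutely summable over `ℤ` with no pairing.  (`Ω = 0` is `…PPKernelTrueNumerator`; here `m` is arbitrary but the summability route needs `e + u − iΩ ≠ 0`, automatic for `m ≠ 0`.)
* §1 `ppFreqZ`, `ppBose`, `ppBose_sub_ppFreqZ` (`Ω − ωₙ = ω_{m−1−n}`), `abs_ppFreqZ_ge`, shifted-lattice summability via `Literature…tsum_int_matsubara_shift`'s `Equiv`;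
* §2 `ppShiftSummand`, `ppShiftNumerator`, `ppShiftSummand_eq_prod` (product form), `norm_ppShiftSummand_le`, `summable_ppShiftSummand`, `ppShiftNumerator_symm`;
* §3 `ppShiftSummandDu`, `ppShiftNumeratorDu`, **`hasDerivAt_ppShiftNumerator_u`** (termwise differentiation over `ℤ`, uniform dominator
  `(2B₁/Λ)(2Λ²/((Ω−ωₙ)²+Λ²))(2β/π) + 1/(Ω−ωₙ)²`), **`hasDerivAt_ppShiftNumerator_e`** (by symmetry).
Pure real/complex analysis on Literature objects; nothing asserts (C), K3 or superconductivity.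
References: BGM 2006 §2.1 (2.3), §2.4 [cite: BenfattoGiulianiMastropietro2006]; Salmhofer 1999 §4.2.5 [cite: Salmhofer1999].
-/

noncomputable section

namespace Summit.HubbardSuperconductivity.HubbardSuperconductivity.Theorems.C4a

set_option linter.dupNamespace false -- summit = problem name (single-conjunct summit), D-0017

open Real Filter Set Complex
open scoped Topology
open Literature.MathematicalPhysics.QuantumLattice Literature.Analysis.SpecialFunctions

/-! ## §1 The `ℤ`-indexed fermionic lattice and bosonic shifts -/

/-- `ωₙ = (2n+1)π/β`, `n ∈ ℤ`. -/
def ppFreqZ (β : ℝ) (n : ℤ) : ℝ := (2 * n + 1) * π / β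

/-- `Ω = 2mπ/β`, `m ∈ ℤ` (bosonic). -/
def ppBose (β : ℝ) (m : ℤ) : ℝ := 2 * m * π / β

/-- `Ω − ωₙ = ω_{m−1−n}`. [cite: BenfattoGiulianiMastropietro2006, §2.1 (2.2)-(2.5)] -/
theorem ppBose_sub_ppFreqZ (β : ℝ) (m n : ℤ) : ppBose β m - ppFreqZ β n = ppFreqZ β (m - 1 - n) := by
  unfold ppBose ppFreqZ
  exact matsubara_bosonic_sub_fermionic β m n

/-- `π/β ≤ |ωₙ|` (`β > 0`). [cite: BenfattoGiulianiMastropietro2006, §2.1 (2.2)-(2.5)] -/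
theorem abs_ppFreqZ_ge {β : ℝ} (hβ : 0 < β) (n : ℤ) : π / β ≤ |ppFreqZ β n| := by
  unfold ppFreqZ
  rw [abs_div, abs_of_pos hβ, div_le_div_iff_of_pos_right hβ, abs_mul, abs_of_pos Real.pi_pos]
  have h : (1 : ℝ) ≤ |2 * (n : ℝ) + 1| := by
    rcases le_or_gt 0 n with hn | hn
    · rw [abs_of_nonneg (by positivity)]
      have : (0 : ℝ) ≤ n := by exact_mod_cast hn
      linarith
    · have : (n : ℝ) ≤ -1 := by exact_mod_cast (Int.le_sub_one_of_lt hn)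
      rw [abs_of_neg (by linarith)]
      linarith
  nlinarith [Real.pi_pos]

/-- `ωₙ ≠ 0`, and `0 < ωₙ²`. [folklore] -/
theorem ppFreqZ_ne_zero {β : ℝ} (hβ : 0 < β) (n : ℤ) : ppFreqZ β n ≠ 0 := by
  have h := abs_ppFreqZ_ge hβ n
  have hp : 0 < π / β := by positivity
  intro h0
  rw [h0, abs_zero] at h
  linarith

/-- `1/|ωₙ| ≤ β/π`. [folklore] -/
theorem inv_abs_ppFreqZ_le {β : ℝ} (hβ : 0 < β) (n : ℤ) : 1 / |ppFreqZ β n| ≤ β / π := by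
  have h := abs_ppFreqZ_ge hβ n
  have hp : 0 < π / β := by positivity
  rw [div_le_div_iff₀ (hp.trans_le h) Real.pi_pos, one_mul]
  rw [div_le_iff₀ hβ] at h
  linarith

/-- `Σ_{n∈ℤ} 1/(ωₙ² + a²)` converges. [cite: BenfattoGiulianiMastropietro2006, §2.1 (2.2)-(2.5)] -/
theorem summable_one_div_ppFreqZ_sq_add_sq {β : ℝ} (hβ : 0 < β) (a : ℝ) : Summable fun n : ℤ => 1 / (ppFreqZ β n ^ 2 + a ^ 2) := by
  simpa [ppFreqZ] using summable_int_one_div_matsubara_sq_add_sq hβ a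

/-- Shifted lattice: `Σ_{n∈ℤ} 1/((Ω−ωₙ)² + a²)` converges (re-indexing). [cite: BenfattoGiulianiMastropietro2006, §2.1 (2.2)-(2.5)] -/
theorem summable_one_div_shift_sq_add_sq {β : ℝ} (hβ : 0 < β) (m : ℤ) (a : ℝ) :
    Summable fun n : ℤ => 1 / ((ppBose β m - ppFreqZ β n) ^ 2 + a ^ 2) := by
  have h : (fun n : ℤ => 1 / ((ppBose β m - ppFreqZ β n) ^ 2 + a ^ 2)) = (fun k : ℤ => 1 / (ppFreqZ β k ^ 2 + a ^ 2)) ∘ (Equiv.subLeft (m - 1)) := by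
    funext n; simp only [Function.comp, Equiv.subLeft_apply, ppBose_sub_ppFreqZ]
  rw [h, Equiv.summable_iff]
  exact summable_one_div_ppFreqZ_sq_add_sq hβ a

/-- Shifted lattice sums equal unshifted ones: `Σ_{n∈ℤ} g(Ω − ωₙ) = Σ_{n∈ℤ} g(ωₙ)`. [cite: BenfattoGiulianiMastropietro2006, §2.1 (2.2)-(2.5)] -/
theorem tsum_shift_eq {E : Type*} [AddCommMonoid E] [TopologicalSpace E] (g : ℝ → E) (β : ℝ) (m : ℤ) :
    ∑' n : ℤ, g (ppBose β m - ppFreqZ β n) = ∑' n : ℤ, g (ppFreqZ β n) := by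
  unfold ppBose ppFreqZ
  exact tsum_int_matsubara_shift g β m

/-- `1/max(|ω|,Λ/2)² ≤ 8/(ω² + Λ²)`. [folklore] -/
theorem inv_max_sq_le {Λ : ℝ} (hΛ : 0 < Λ) (ω : ℝ) : 1 / max |ω| (Λ / 2) ^ 2 ≤ 8 / (ω ^ 2 + Λ ^ 2) := by
  have hm : 0 < max |ω| (Λ / 2) := lt_max_of_lt_right (by positivity)
  rw [div_le_div_iff₀ (by positivity) (by positivity), one_mul]
  have h1 : |ω| ≤ max |ω| (Λ / 2) := le_max_left _ _
  have h2 : Λ / 2 ≤ max |ω| (Λ / 2) := le_max_right _ _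
  have h1' : ω ^ 2 ≤ max |ω| (Λ / 2) ^ 2 := by rw [← sq_abs]; exact pow_le_pow_left₀ (abs_nonneg _) h1 2
  have h2' : (Λ / 2) ^ 2 ≤ max |ω| (Λ / 2) ^ 2 := pow_le_pow_left₀ (by positivity) h2 2
  nlinarith

/-! ## §2 The shifted numerator -/

/-- One summand of `N_Ω`: `W(ωₙ,e)W(Ω−ωₙ,u)[1/(−iωₙ+e) + 1/(−i(Ω−ωₙ)+u)]`. -/
def ppShiftSummand (β Λ : ℝ) (m : ℤ) (e u : ℝ) (n : ℤ) : ℂ :=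
  ((uvWeightFn Λ (ppFreqZ β n) e : ℝ) : ℂ) * ((uvWeightFn Λ (ppBose β m - ppFreqZ β n) u : ℝ) : ℂ) *
    (resolventFnXi 1 0 (ppFreqZ β n) e + resolventFnXi 1 0 (ppBose β m - ppFreqZ β n) u)

/-- **`N_Ω(e,u) = (1/β)Σ_{n∈ℤ} ppShiftSummand`**. -/
def ppShiftNumerator (β Λ : ℝ) (m : ℤ) (e u : ℝ) : ℂ := ((1 / β : ℝ) : ℂ) * ∑' n : ℤ, ppShiftSummand β Λ m e u n

/-- The transfer denominator is nonzero off the diagonal plane: `m ≠ 0 ⟹ e + u − iΩ ≠ 0`. [folklore] -/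
theorem transferDen_ne_zero {β : ℝ} (hβ : 0 < β) {m : ℤ} (hm : m ≠ 0) (e u : ℝ) : (e : ℂ) + u - I * (ppBose β m : ℝ) ≠ 0 := by
  intro h
  have him := congrArg Complex.im h
  simp at him
  unfold ppBose at him
  have : (2 * (m : ℝ) * π / β) = 0 := by linarith
  rw [div_eq_zero_iff] at this
  rcases this with h1 | h1
  · have : (m : ℝ) = 0 := by nlinarith [Real.pi_pos]
    exact hm (by exact_mod_cast this)
  · exact hβ.ne' h1

/-- **Product form**: `ppShiftSummand n = Ψ̂(ωₙ,e)·Ψ̂(Ω−ωₙ,u)·(e + u − iΩ)` whenever `e + u − iΩ ≠ 0` (partial fractions of `…RatioForm`).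
[cite: BenfattoGiulianiMastropietro2006, §2.1 (2.3)] -/
theorem ppShiftSummand_eq_prod {β Λ : ℝ} (hΛ : 0 < Λ) (m : ℤ) (e u : ℝ) (hs : (e : ℂ) + u - I * (ppBose β m : ℝ) ≠ 0) (n : ℤ) :
    ppShiftSummand β Λ m e u n =
      uvSymbolFnXi 1 Λ (ppFreqZ β n) e * uvSymbolFnXi 1 Λ (ppBose β m - ppFreqZ β n) u * ((e : ℂ) + u - I * (ppBose β m : ℝ)) := by
  have h := uvSymbolFnXi_mul_eq_div hΛ (ppFreqZ β n) (ppBose β m) e u hs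
  rw [h, ppShiftSummand, div_mul_cancel₀ _ hs]

/-- **Norm of one summand**: `‖ppShiftSummand n‖ ≤ 4‖e+u−iΩ‖·(1/(ωₙ²+Λ²) + 1/((Ω−ωₙ)²+Λ²))`. [cite: BenfattoGiulianiMastropietro2006, §2.1 (2.3)] -/
theorem norm_ppShiftSummand_le {β Λ : ℝ} (hΛ : 0 < Λ) (m : ℤ) (e u : ℝ) (hs : (e : ℂ) + u - I * (ppBose β m : ℝ) ≠ 0) (n : ℤ) :
    ‖ppShiftSummand β Λ m e u n‖ ≤ 4 * ‖(e : ℂ) + u - I * (ppBose β m : ℝ)‖ * (1 / (ppFreqZ β n ^ 2 + Λ ^ 2) + 1 / ((ppBose β m - ppFreqZ β n) ^ 2 + Λ ^ 2)) := by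
  rw [ppShiftSummand_eq_prod hΛ m e u hs n, norm_mul, norm_mul]
  have h1 : ‖uvSymbolFnXi 1 Λ (ppFreqZ β n) e‖ ≤ 1 / max |ppFreqZ β n| (Λ / 2) := by
    rw [← uvSymbolFn_eq_uvSymbolFnXi]; exact norm_uvSymbolFn_le hΛ zero_le_one _
  have h2 : ‖uvSymbolFnXi 1 Λ (ppBose β m - ppFreqZ β n) u‖ ≤ 1 / max |ppBose β m - ppFreqZ β n| (Λ / 2) := by
    rw [← uvSymbolFn_eq_uvSymbolFnXi]; exact norm_uvSymbolFn_le hΛ zero_le_one _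
  have ha := inv_max_sq_le hΛ (ppFreqZ β n)
  have hb := inv_max_sq_le hΛ (ppBose β m - ppFreqZ β n)
  set a := 1 / max |ppFreqZ β n| (Λ / 2) with hadef
  set b := 1 / max |ppBose β m - ppFreqZ β n| (Λ / 2) with hbdef
  have ha0 : 0 ≤ a := by positivity
  have hb0 : 0 ≤ b := by positivity
  have hab : a * b ≤ 4 * (1 / (ppFreqZ β n ^ 2 + Λ ^ 2) + 1 / ((ppBose β m - ppFreqZ β n) ^ 2 + Λ ^ 2)) := by
    have h4 : a ^ 2 ≤ 8 * (1 / (ppFreqZ β n ^ 2 + Λ ^ 2)) := by rw [hadef, one_div_pow, ← div_eq_mul_one_div]; exact ha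
    have h5 : b ^ 2 ≤ 8 * (1 / ((ppBose β m - ppFreqZ β n) ^ 2 + Λ ^ 2)) := by rw [hbdef, one_div_pow, ← div_eq_mul_one_div]; exact hb
    nlinarith [sq_nonneg (a - b), h4, h5]
  calc ‖uvSymbolFnXi 1 Λ (ppFreqZ β n) e‖ * ‖uvSymbolFnXi 1 Λ (ppBose β m - ppFreqZ β n) u‖ * ‖(e : ℂ) + u - I * (ppBose β m : ℝ)‖
      ≤ a * b * ‖(e : ℂ) + u - I * (ppBose β m : ℝ)‖ := by
        refine mul_le_mul_of_nonneg_right (mul_le_mul h1 h2 (norm_nonneg _) ha0) (norm_nonneg _)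
    _ ≤ 4 * (1 / (ppFreqZ β n ^ 2 + Λ ^ 2) + 1 / ((ppBose β m - ppFreqZ β n) ^ 2 + Λ ^ 2)) * ‖(e : ℂ) + u - I * (ppBose β m : ℝ)‖ :=
        mul_le_mul_of_nonneg_right hab (norm_nonneg _)
    _ = _ := by ring

/-- **Summability of `N_Ω`'s series** (`m ≠ 0`). [cite: BenfattoGiulianiMastropietro2006, §2.1 (2.3)] -/
theorem summable_ppShiftSummand {β Λ : ℝ} (hβ : 0 < β) (hΛ : 0 < Λ) {m : ℤ} (hm : m ≠ 0) (e u : ℝ) :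
    Summable (ppShiftSummand β Λ m e u) := by
  have hs := transferDen_ne_zero hβ hm e u
  refine Summable.of_norm_bounded ((((summable_one_div_ppFreqZ_sq_add_sq hβ Λ).add (summable_one_div_shift_sq_add_sq hβ m Λ))).mul_left
    (4 * ‖(e : ℂ) + u - I * (ppBose β m : ℝ)‖)) fun n => ?_
  exact norm_ppShiftSummand_le hΛ m e u hs n

/-- **Symmetry** `N_Ω(e,u) = N_Ω(u,e)` (re-indexing `n ↦ m − 1 − n` exchanges the two lines). [cite: BenfattoGiulianiMastropietro2006, §2.1 (2.3)] -/
theorem ppShiftNumerator_symm (β Λ : ℝ) (m : ℤ) (e u : ℝ) : ppShiftNumerator β Λ m e u = ppShiftNumerator β Λ m u e := by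
  unfold ppShiftNumerator
  congr 1
  have h : ∀ n : ℤ, ppShiftSummand β Λ m e u n = (fun k : ℤ => ppShiftSummand β Λ m u e k) ((Equiv.subLeft (m - 1)) n) := fun n => by
    simp only [Equiv.subLeft_apply, ppShiftSummand]
    have h1 : ppBose β m - ppFreqZ β (m - 1 - n) = ppFreqZ β n := by
      rw [ppBose_sub_ppFreqZ]; congr 1; ring
    rw [h1, ppBose_sub_ppFreqZ]
    ring
  simp_rw [h]
  exact Equiv.tsum_eq (Equiv.subLeft (m - 1)) _

/-! ## §3 Level derivatives everywhere -/

/-- One summand of `∂ᵤN_Ω`: `W(ωₙ,e)·[W′(ω′,u)(r(ωₙ,e) + r(ω′,u)) + W(ω′,u)·r′(ω′,u)]`, `ω′ = Ω − ωₙ`. -/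
def ppShiftSummandDu (β Λ : ℝ) (m : ℤ) (e u : ℝ) (n : ℤ) : ℂ :=
  ((uvWeightFn Λ (ppFreqZ β n) e : ℝ) : ℂ) *
    (((uvWeightFnD1 Λ (ppBose β m - ppFreqZ β n) u : ℝ) : ℂ) * (resolventFnXi 1 0 (ppFreqZ β n) e + resolventFnXi 1 0 (ppBose β m - ppFreqZ β n) u) +
      ((uvWeightFn Λ (ppBose β m - ppFreqZ β n) u : ℝ) : ℂ) * resolventFnXiD1 1 0 (ppBose β m - ppFreqZ β n) u)

/-- `∂ᵤN_Ω = (1/β)Σ ppShiftSummandDu`. -/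
def ppShiftNumeratorDu (β Λ : ℝ) (m : ℤ) (e u : ℝ) : ℂ := ((1 / β : ℝ) : ℂ) * ∑' n : ℤ, ppShiftSummandDu β Λ m e u n

/-- The resolvent is bounded by `β/π` on the fermionic lattice: `‖1/(−iω+x)‖ ≤ 1/|ω| ≤ β/π`. [folklore] -/
theorem norm_resolventFnXi_le_freq {β : ℝ} (hβ : 0 < β) {ω : ℝ} (hω : π / β ≤ |ω|) (x : ℝ) : ‖resolventFnXi 1 0 ω x‖ ≤ β / π := by
  have hp : 0 < π / β := by positivity
  have hω0 : 0 < |ω| := hp.trans_le hω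
  rw [norm_resolventFnXi zero_le_one]
  have hden : |ω| ≤ ‖-I * ((ω + 0 : ℝ) : ℂ) + (x : ℂ)‖ := abs_le_norm_uvDen x ω
  calc (1 : ℝ) / ‖-I * ((ω + 0 : ℝ) : ℂ) + (x : ℂ)‖ ≤ 1 / |ω| := div_le_div_of_nonneg_left zero_le_one hω0 hden
    _ ≤ β / π := by
        rw [div_le_div_iff₀ hω0 Real.pi_pos, one_mul]
        rw [div_le_iff₀ hβ] at hω; linarith

/-- The resolvent's derivative is `O(1/ω²)`: `‖r′(ω,x)‖ ≤ 1/ω²` (`ω ≠ 0`). [folklore] -/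
theorem norm_resolventFnXiD1_le_inv_sq {ω : ℝ} (hω : ω ≠ 0) (x : ℝ) : ‖resolventFnXiD1 1 0 ω x‖ ≤ 1 / ω ^ 2 := by
  rw [norm_resolventFnXiD1 zero_le_one]
  have hden : |ω| ≤ ‖-I * ((ω + 0 : ℝ) : ℂ) + (x : ℂ)‖ := abs_le_norm_uvDen x ω
  have hω0 : 0 < |ω| := abs_pos.2 hω
  have h : ω ^ 2 ≤ ‖-I * ((ω + 0 : ℝ) : ℂ) + (x : ℂ)‖ ^ 2 := by rw [← sq_abs]; exact pow_le_pow_left₀ hω0.le hden 2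
  exact div_le_div_of_nonneg_left zero_le_one (by positivity) h

/-- **The uniform dominator of `∂ᵤN_Ω`'s series**: `‖ppShiftSummandDu n‖ ≤ (2B₁/Λ)(2Λ²/((Ω−ωₙ)²+Λ²))(2β/π) + 1/((Ω−ωₙ)² + 0²)`, uniformly in `e, u`.
[cite: BenfattoGiulianiMastropietro2006, §2.4 (2.36)] -/
theorem norm_ppShiftSummandDu_le {β Λ : ℝ} (hβ : 0 < β) (hΛ : 0 < Λ) {B₁ : ℝ} (hB₁ : ∀ x, |deriv salmhoferCutoff x| ≤ B₁) (m : ℤ) (e u : ℝ) (n : ℤ) :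
    ‖ppShiftSummandDu β Λ m e u n‖ ≤
      2 * B₁ / Λ * (2 * Λ ^ 2 / ((ppBose β m - ppFreqZ β n) ^ 2 + Λ ^ 2)) * (2 * (β / π)) + 1 / ((ppBose β m - ppFreqZ β n) ^ 2 + 0 ^ 2) := by
  have hB0 := salmhoferB₁_nonneg hB₁
  set ω' : ℝ := ppBose β m - ppFreqZ β n with hω'
  have hω'ne : ω' ≠ 0 := by rw [hω', ppBose_sub_ppFreqZ]; exact ppFreqZ_ne_zero hβ _
  have hr1 : ‖resolventFnXi 1 0 (ppFreqZ β n) e‖ ≤ β / π := norm_resolventFnXi_le_freq hβ (abs_ppFreqZ_ge hβ n) e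
  have hr2 : ‖resolventFnXi 1 0 ω' u‖ ≤ β / π := by
    refine norm_resolventFnXi_le_freq hβ ?_ u
    rw [hω', ppBose_sub_ppFreqZ]; exact abs_ppFreqZ_ge hβ _
  have hW : ‖((uvWeightFn Λ (ppFreqZ β n) e : ℝ) : ℂ)‖ ≤ 1 := by rw [Complex.norm_real, Real.norm_eq_abs]; exact abs_uvWeightFn_le_one _ _ _
  have hW' : ‖((uvWeightFnD1 Λ ω' u : ℝ) : ℂ)‖ ≤ 2 * B₁ / Λ * (2 * Λ ^ 2 / (ω' ^ 2 + Λ ^ 2)) := by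
    rw [Complex.norm_real, Real.norm_eq_abs]; exact abs_uvWeightFnD1_le_shell hB₁ hΛ ω' u
  have hW2 : ‖((uvWeightFn Λ ω' u : ℝ) : ℂ)‖ ≤ 1 := by rw [Complex.norm_real, Real.norm_eq_abs]; exact abs_uvWeightFn_le_one _ _ _
  have hD1 : ‖resolventFnXiD1 1 0 ω' u‖ ≤ 1 / (ω' ^ 2 + 0 ^ 2) := by
    rw [zero_pow two_ne_zero, add_zero]; exact norm_resolventFnXiD1_le_inv_sq hω'ne u
  unfold ppShiftSummandDu
  rw [← hω']
  calc ‖((uvWeightFn Λ (ppFreqZ β n) e : ℝ) : ℂ) * (((uvWeightFnD1 Λ ω' u : ℝ) : ℂ) * (resolventFnXi 1 0 (ppFreqZ β n) e + resolventFnXi 1 0 ω' u) +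
        ((uvWeightFn Λ ω' u : ℝ) : ℂ) * resolventFnXiD1 1 0 ω' u)‖
      ≤ 1 * (2 * B₁ / Λ * (2 * Λ ^ 2 / (ω' ^ 2 + Λ ^ 2)) * (2 * (β / π)) + 1 / (ω' ^ 2 + 0 ^ 2)) := by
        rw [norm_mul]
        refine mul_le_mul hW ((norm_add_le _ _).trans (add_le_add ?_ ?_)) (norm_nonneg _) zero_le_one
        · rw [norm_mul]
          refine mul_le_mul hW' ((norm_add_le _ _).trans ?_) (norm_nonneg _) (by positivity)
          linarith
        · rw [norm_mul]
          calc ‖((uvWeightFn Λ ω' u : ℝ) : ℂ)‖ * ‖resolventFnXiD1 1 0 ω' u‖ ≤ 1 * (1 / (ω' ^ 2 + 0 ^ 2)) := mul_le_mul hW2 hD1 (norm_nonneg _) zero_le_one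
            _ = 1 / (ω' ^ 2 + 0 ^ 2) := one_mul _
    _ = _ := one_mul _

/-- The dominator is summable. [folklore] -/
theorem summable_ppShiftDominator {β Λ : ℝ} (hβ : 0 < β) (B₁ c : ℝ) (m : ℤ) :
    Summable fun n : ℤ => 2 * B₁ / Λ * (2 * Λ ^ 2 / ((ppBose β m - ppFreqZ β n) ^ 2 + Λ ^ 2)) * c + 1 / ((ppBose β m - ppFreqZ β n) ^ 2 + 0 ^ 2) := by
  refine Summable.add ?_ (summable_one_div_shift_sq_add_sq hβ m 0)
  have h := (summable_one_div_shift_sq_add_sq hβ m Λ).mul_left (2 * B₁ / Λ * (2 * Λ ^ 2) * c)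
  refine h.congr fun n => ?_
  field_simp

/-- **`∂ᵤ` of one summand** (everywhere). [cite: BenfattoGiulianiMastropietro2006, §2.4 (2.36)] -/
theorem hasDerivAt_ppShiftSummand_u {β : ℝ} (hβ : 0 < β) (Λ : ℝ) (m : ℤ) (e : ℝ) (n : ℤ) (v : ℝ) :
    HasDerivAt (fun y => ppShiftSummand β Λ m e y n) (ppShiftSummandDu β Λ m e v n) v := by
  set ω' : ℝ := ppBose β m - ppFreqZ β n with hω'
  have hω'ne : ω' ≠ 0 := by rw [hω', ppBose_sub_ppFreqZ]; exact ppFreqZ_ne_zero hβ _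
  have hden : (-I * ((ω' + 0 : ℝ) : ℂ) + (v : ℂ)) ≠ 0 := by
    intro h
    have h1 := abs_le_norm_uvDen v ω'
    rw [h, norm_zero] at h1
    exact hω'ne (abs_eq_zero.1 (le_antisymm h1 (abs_nonneg _)))
  have hW : HasDerivAt (fun y => ((uvWeightFn Λ ω' y : ℝ) : ℂ)) ((uvWeightFnD1 Λ ω' v : ℝ) : ℂ) v := (hasDerivAt_uvWeightFn Λ ω' v).ofReal_comp
  have hR : HasDerivAt (fun y => resolventFnXi 1 0 ω' y) (resolventFnXiD1 1 0 ω' v) v := hasDerivAt_resolventFnXi hden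
  have h := ((hW.fun_mul (hR.const_add (resolventFnXi 1 0 (ppFreqZ β n) e))).const_mul (((uvWeightFn Λ (ppFreqZ β n) e : ℝ) : ℂ)))
  refine (h.congr_of_eventuallyEq (Eventually.of_forall fun y => by simp only [ppShiftSummand, ← hω']; ring)).congr_deriv ?_
  simp only [ppShiftSummandDu, ← hω']

/-- **`∂ᵤN_Ω` exists everywhere and is `ppShiftNumeratorDu`** (`m ≠ 0`). [cite: BenfattoGiulianiMastropietro2006, §2.4 (2.36)] -/
theorem hasDerivAt_ppShiftNumerator_u {β Λ : ℝ} (hβ : 0 < β) (hΛ : 0 < Λ) {B₁ : ℝ} (hB₁ : ∀ x, |deriv salmhoferCutoff x| ≤ B₁) {m : ℤ} (hm : m ≠ 0)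
    (e u : ℝ) : HasDerivAt (fun v => ppShiftNumerator β Λ m e v) (ppShiftNumeratorDu β Λ m e u) u := by
  unfold ppShiftNumerator ppShiftNumeratorDu
  refine HasDerivAt.const_mul _ ?_
  exact hasDerivAt_tsum (summable_ppShiftDominator hβ B₁ (2 * (β / π)) m) (fun n y => hasDerivAt_ppShiftSummand_u hβ Λ m e n y)
    (fun n y => norm_ppShiftSummandDu_le hβ hΛ hB₁ m e y n) (y₀ := u) (summable_ppShiftSummand hβ hΛ hm e u) u

/-- **`∂ₑN_Ω`** = `ppShiftNumeratorDu β Λ m u e` by the symmetry. [cite: BenfattoGiulianiMastropietro2006, §2.4 (2.36)] -/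
theorem hasDerivAt_ppShiftNumerator_e {β Λ : ℝ} (hβ : 0 < β) (hΛ : 0 < Λ) {B₁ : ℝ} (hB₁ : ∀ x, |deriv salmhoferCutoff x| ≤ B₁) {m : ℤ} (hm : m ≠ 0)
    (e u : ℝ) : HasDerivAt (fun x => ppShiftNumerator β Λ m x u) (ppShiftNumeratorDu β Λ m u e) e := by
  have hfun : (fun x => ppShiftNumerator β Λ m x u) = fun x => ppShiftNumerator β Λ m u x := funext fun x => ppShiftNumerator_symm β Λ m x u
  rw [hfun]
  exact hasDerivAt_ppShiftNumerator_u hβ hΛ hB₁ hm u e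

end Summit.HubbardSuperconductivity.HubbardSuperconductivity.Theorems.C4a

end
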